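import Summits.Ventures.YMGap.RobustBall.HeatBathPoincare
import Summits.Ventures.YMGap.Thresholds.OneLinkModulusSU3Twisted
import HarnessLib

/-!
# Robust ball (Y2) — the heat-bath Poincaré inequality for `SU(3)`, `d = 4`, on the TWISTED-modulus window `0 ≤ β_W < 1000/3531`

HONEST FRAMING: venture file of the cell `pub-ymgap` (QuantumFields programme), track ROBUST-BALL, seat rb-p2 (g13); a CELL of `HeatBathPoincare.lean`
(`heatBathPoincare_of_oneLinkKRModulus`: the single-link heat-bath (Glauber) Poincaré inequality uniformly in the volume from a one-link Kantorovich–Rubinstein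
modulus) for `SU(3)` Wilson lattice Yang–Mills on `(ℤ/L)⁴`, `L ≥ 2`; LATTICE statement at STRONG COUPLING, Wilson action (class K); nothing about `β → ∞`,
the continuum or Clay.
★★ `su3_heatBathPoincare_pv2t` — `SU(3)`, HYPOTHESIS-FREE on `0 ≤ β_W < 1000/3531 ≈ 0.2832` (tree coupling `β_W/3`, 't Hooft `β_W/9`), with engine-2's certified
TWISTED modulus `TwistedBochner.su3_oneLinkKRModulus_pv2t_oneFifth : OneLinkKRModulus 3 (1/5) (3531/2000)` (`OneLinkModulusSU3Twisted.lean`; radius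
`6·β_W/9 ≤ 1/5` iff `β_W ≤ 3/10`): column sum `c = 18 (β_W/9) (3531/2000) = 3531 β_W/1000`, constant `(2(1 − 3531β_W/1000))⁻¹`.  This supersedes the PV2 cell
`HeatBathPoincare.su3_heatBathPoincare_pv2` (`β_W < 625/2679 ≈ 0.233`) of `HeatBathPoincareCells.lean`.  For comparison: the Bakry–Émery window of the
Langevin Poincaré inequality for `SU(3)`, `d = 4` is 't Hooft `1/32`, i.e. `β_W < 9/32 = 0.28125` (venture `SharpPoincare`) — the twisted KR window `0.28320…`
is larger by a hair; Shen–Zhu–Zhu's printed window is `β_W < 9/48`.  0 sorry, 0 definitions.  Everything here is proved. [folklore]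
-/

noncomputable section

open MeasureTheory Function
open Literature.MathematicalPhysics.QuantumLattice
open Literature.MathematicalPhysics.QuantumFieldTheory

namespace Summit.Ventures.YMGap.RobustBall.HeatBathPoincare

variable {L : ℕ} [NeZero L]

/-- ★★ **`SU(3)`, `d = 4`, HYPOTHESIS-FREE (twisted modulus `OneLinkKRModulus 3 (1/5) (3531/2000)`): the heat-bath Poincaré inequality uniformly in the volume on
`0 ≤ β_W < 1000/3531 ≈ 0.2832`** (tree coupling `β_W/3`; constant `(2(1 − 3531β_W/1000))⁻¹`, every torus side `L ≥ 2`): for every bounded measurable `F`,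
`Var_μ(F) ≤ (2(1 − 3531β_W/1000))⁻¹ ∑_ℓ ∫∫ (F(U) − F(U[ℓ ↦ g]))² dν_ℓ^U dμ` — Glauber spectral gap `≥ 1 − 3531β_W/1000` (the standard reading). [folklore] -/
theorem su3_heatBathPoincare_pv2t {βW : ℝ} (h0 : 0 ≤ βW) (h : βW < 1000 / 3531) (hL : 1 < L)
    (F : GaugeConfig 4 L (Matrix.specialUnitaryGroup (Fin 3) ℂ) → ℝ) (hF : Measurable F) (hFb : ∃ M : ℝ, ∀ U, |F U| ≤ M) :
    ProbabilityTheory.variance F (wilsonMeasure (d := 4) (L := L) (fundamentalRep (Fin 3)) (βW / 3)) ≤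
      (2 * (1 - 3531 * βW / 1000))⁻¹ * ∑ ℓ : Edge 4 L, ∫ U, ∫ g, (F U - F (update U ℓ g)) ^ 2
        ∂((haarProbability (Matrix.specialUnitaryGroup (Fin 3) ℂ)).tilted
            (fun g' => -(βW / 3) * wilsonAction (fundamentalRep (Fin 3)) (update U ℓ g')))
        ∂(wilsonMeasure (d := 4) (L := L) (fundamentalRep (Fin 3)) (βW / 3)) := by
  have habs : |βW / 3| / ((3 : ℕ) : ℝ) = βW / 9 := by rw [abs_of_nonneg (by positivity)]; push_cast; ring
  exact heatBathPoincare_of_oneLinkKRModulus (N := 3) (by norm_num) (β := βW / 3) (by norm_num) (R := 1 / 5)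
    (by rw [habs]; linarith) TwistedBochner.su3_oneLinkKRModulus_pv2t_oneFifth (c := 3531 * βW / 1000)
    (by rw [habs]; linarith) (by rw [div_lt_one (by norm_num)]; linarith) hL F hF hFb

/-- **Odd tori of side `≥ 3`** (`SU(3)`, `0 ≤ β_W < 1000/3531`): the same inequality on `(ℤ/(2S+1))⁴`, `S ≥ 1` — the YangMills summit's `UP(r, β)` shape. [folklore] -/
theorem su3_heatBathPoincare_pv2t_oddTorus {βW : ℝ} (h0 : 0 ≤ βW) (h : βW < 1000 / 3531) (S : ℕ) (hS : 1 ≤ S)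
    (F : GaugeConfig 4 (2 * S + 1) (Matrix.specialUnitaryGroup (Fin 3) ℂ) → ℝ) (hF : Measurable F) (hFb : ∃ M : ℝ, ∀ U, |F U| ≤ M) :
    ProbabilityTheory.variance F (wilsonMeasure (d := 4) (L := 2 * S + 1) (fundamentalRep (Fin 3)) (βW / 3)) ≤
      (2 * (1 - 3531 * βW / 1000))⁻¹ * ∑ ℓ : Edge 4 (2 * S + 1), ∫ U, ∫ g, (F U - F (update U ℓ g)) ^ 2
        ∂((haarProbability (Matrix.specialUnitaryGroup (Fin 3) ℂ)).tilted
            (fun g' => -(βW / 3) * wilsonAction (fundamentalRep (Fin 3)) (update U ℓ g')))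
        ∂(wilsonMeasure (d := 4) (L := 2 * S + 1) (fundamentalRep (Fin 3)) (βW / 3)) :=
  su3_heatBathPoincare_pv2t h0 h (by omega) F hF hFb

end Summit.Ventures.YMGap.RobustBall.HeatBathPoincare

end
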